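import Summits.CriticalPhenomena.CardyFormulaZ2.Theorems.CardyUniqueLimitCardyRigidityStubPercCapacityClock
import Summits.CriticalPhenomena.CardyFormulaZ2.Theorems.CardyUniqueLimitCardyRigiditySlitCrossingFreezing
import Summits.CriticalPhenomena.CardyFormulaZ2.Theorems.CardyUniqueLimitCardyRigiditySlitCrossingEventIdentity
import HarnessLib

/-!
# Cut-1 of STUB A3b, clock side: earlier clocks stay strictly below the cap

Crux `Summit.CriticalPhenomena.CardyFormulaZ2.Theses.CardyUniqueLimit.CardyRigidity`
(stmt-CriticalPhenomena-0746), line `crossing_martingale`, stub A3b, cut "freezing at the level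
step".  A one-lemma companion of `…SlitCardyCutClock.lean` with the SAME import header (it also
probes the hub build of that import closure, whose module `…SlitCardyCutClock` has stayed without
an olean since its acceptance): if the prefix of depth `n` has a capacity time `T < L`, every
prefix of depth `i ≤ n` has a capacity time `≤ T`, so its capped clock is `< L` and IS that
capacity time (`CapacityClock.hasCap_clock_of_lt` applies at every earlier depth).
(buildfix 2026-08-20: comment-only re-land to re-enqueue the module build after its blocking imports were repaired; no declaration changed.)
-/

noncomputable section

open Set
open scoped NNReal unitInterval
open UpperHalfPlane (upperHalfPlaneSet)
open Literature.Probability Literature.Probability.RandomPlanarGeometry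
  Literature.Probability.LatticeModels Literature.Probability.LatticeModels.DiscreteDobrushin
open Literature.Probability.Percolation (bondInterfaceIn BondConfig)

namespace Summit.CriticalPhenomena.CardyFormulaZ2.Cruxes.CardyRigidity.CrossingMartingale

namespace SlitCardyCut

open CapacityClock

variable {E : DiscreteDobrushin} {D D' : DobrushinDomain}
  {φ' : ConformalEquiv upperHalfPlaneSet D'.carrier}
  (hor : ∀ ω, bondInterfaceIn D E ω =
    CurveClass.mk ⟨polyline ((medialExploration E ω).map (medialPoint E.δ))⟩)
  (hφ' : D'.IsChordalUniformizing φ')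
include hor hφ'

/-- **Earlier prefixes have capacity times below a later one**: if the prefix of depth `n` of a
describable configuration has the capacity time `T`, then every prefix of depth `i ≤ n` has a
capacity time `Tᵢ ≤ T` (the target point is off the shorter prefix trace, and images of trace
segments are ordered by time). [cite: Lawler2005, Ch. 4 §4.1] -/
theorem exists_hasCap_le_of_hasCap {i n : ℕ} (hin : i ≤ n) {ω : BondConfig (Site 2)}
    (hω : IsLoewnerDescribable φ' (bondInterfaceIn D E ω)) {T : ℝ≥0}
    (hT : φ'.boundaryExtension '' (Loewner.trace (drivingFunction φ' (bondInterfaceIn D E ω)) ''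
      Icc 0 T) = range (polyline ((explorationPrefix E n ω).map (medialPoint E.δ)))) :
    ∃ Ti : ℝ≥0, Ti ≤ T ∧ φ'.boundaryExtension ''
      (Loewner.trace (drivingFunction φ' (bondInterfaceIn D E ω)) '' Icc 0 Ti) =
      range (polyline ((explorationPrefix E i ω).map (medialPoint E.δ))) := by
  have hdesc := described_of hor hω
  have hgen := hdesc.exists_eq_mk_trace.1
  have hb : D'.pt 1 ∉ range (polyline ((explorationPrefix E n ω).map (medialPoint E.δ))) := by
    intro hb
    rw [← hT] at hb
    obtain ⟨_, ⟨u, -, rfl⟩, hu⟩ := hb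
    exact MarkedDomain.boundaryExtension_ne_pt_one
      JordanDomain.exists_continuousOn_extension_holds hφ' (hgen.im_nonneg u) hu
  have hsub : range (polyline ((explorationPrefix E i ω).map (medialPoint E.δ))) ⊆
      range (polyline ((explorationPrefix E n ω).map (medialPoint E.δ))) := by
    rw [← image_Iic_polyline_map_eq_range_prefix (medialPoint E.δ) i ω,
      ← image_Iic_polyline_map_eq_range_prefix (medialPoint E.δ) n ω]
    refine image_mono (Iic_subset_Iic.2 ?_)
    show (1 : ℝ) - (1 / 2) ^ (i + 1) ≤ 1 - (1 / 2) ^ (n + 1)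
    have := pow_le_pow_of_le_one (by norm_num : (0 : ℝ) ≤ 1 / 2) (by norm_num)
      (show i + 1 ≤ n + 1 by omega)
    linarith
  have hbi : D'.pt 1 ∉ ((⟨polyline ((medialExploration E ω).map (medialPoint E.δ))⟩ : Curve ℂ) :
      I → ℂ) '' Iic ⟨1 - (1 / 2) ^ (i + 1), one_sub_half_pow_mem_unitInterval _⟩ := by
    change D'.pt 1 ∉ polyline ((medialExploration E ω).map (medialPoint E.δ)) '' _
    rw [image_Iic_polyline_map_eq_range_prefix]
    exact fun h ↦ hb (hsub h)
  obtain ⟨Ti, hTi⟩ := hdesc.exists_image_trace_eq hφ' hbi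
  have hTi' : φ'.boundaryExtension '' (Loewner.trace (drivingFunction φ' (bondInterfaceIn D E ω)) ''
      Icc 0 Ti) = range (polyline ((explorationPrefix E i ω).map (medialPoint E.δ))) := by
    have h := hTi
    change _ = polyline ((medialExploration E ω).map (medialPoint E.δ)) '' _ at h
    rwa [image_Iic_polyline_map_eq_range_prefix] at h
  exact ⟨Ti, (hdesc.image_trace_subset_iff).1 (by rw [hTi', hT]; exact hsub), hTi'⟩

end SlitCardyCut

end Summit.CriticalPhenomena.CardyFormulaZ2.Cruxes.CardyRigidity.CrossingMartingale

end
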